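import Literature.Geometry.Kaehler.TorusDolbeaultLaplacian
import Literature.Analysis.FunctionSpaces.TorusMultiplierBound
import HarnessLib

/-!
# The principal perturbation of the torus `∂̄`-Laplacian is small (Warner 6.29 (1), 6.31)

F. W. Warner, GTM 94 (1983), 6.29 assumes the periodic elliptic operator has "coefficients in the
highest-order part everywhere less than `ε` in absolute value" off the frozen constant part, and
6.31 achieves this by shrinking the neighbourhood `O₀`. For the torus Laplacian of
`TorusDolbeaultLaplacian` we bound the lattice-side principal perturbation
(`Lattice.POp.PrincipalPerturbationLE`) by `δ · K`, where `δ` bounds the oscillation of the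
derivative coefficients of `∂̄`, `∂̄*` on the outer cube region (`ChartOp1.norm_toFOp1_p_le`) and
`K` is a finite constant depending only on the frozen coefficients at the point
(`torusLaplacian_principalPerturbationLE`; multiplier bound
`IsSmooth.eNorm_conv_mFourierCoeff_le`, composition `principalPerturbationLE_comp`, sums
`principalPerturbationLE_add`).

## References

* F. W. Warner, GTM 94 (1983), 6.29 (1), 6.31. [WarnerGTM94]
-/

noncomputable section

open scoped Manifold ContDiff Topology NNReal ENNReal RealInnerProductSpace
open Bundle Set Function Module Metric Complex
open Literature.Analysis.FunctionSpaces Literature.Analysis.FunctionSpaces.Torus Literature.NumberTheory.Transcendental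

set_option maxSynthPendingDepth 2

namespace Literature.Geometry.Kaehler

/-! ### Sums of operators -/

section Add

variable {d : Type*} [Fintype d] {V : Type*} [NormedAddCommGroup V] [InnerProductSpace ℂ V]
  [CompleteSpace V]

/-- **Principal perturbations add**: `(L + L')` has principal perturbation at most `ε + ε'`.
[cite: WarnerGTM94, 6.29 (1)] -/
theorem _root_.Literature.Analysis.FunctionSpaces.Lattice.POp.principalPerturbationLE_add
    {L L' : Lattice.POp d V V} {ε ε' : ℝ≥0∞} (hL : L.PrincipalPerturbationLE ε)
    (hL' : L'.PrincipalPerturbationLE ε') : (L.add L').PrincipalPerturbationLE (ε + ε') := by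
  intro i j c hc
  change Lattice.eNorm 0 (Lattice.conv (L.b i j + L'.b i j) c) ≤ _
  rw [Lattice.add_conv (L.hb i j) (L'.hb i j) ⟨0, hc⟩, add_mul]
  exact (Lattice.eNorm_add_le 0 _ _).trans (add_le_add (hL i j c hc) (hL' i j c hc))

end Add

/-! ### The perturbation bound for one transferred operator -/

section One

variable {E : Type*} [NormedAddCommGroup E] [NormedSpace ℝ E] {n : ℕ}
  {M : Type*} [TopologicalSpace M] [ChartedSpace E M]
  {F F' : Type*} [NormedAddCommGroup F] [NormedSpace ℂ F] [NormedAddCommGroup F'] [NormedSpace ℂ F']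
  {k k' : ℕ}
  {V W : Type*} [NormedAddCommGroup V] [InnerProductSpace ℂ V] [CompleteSpace V] [FiniteDimensional ℂ V]
  [NormedAddCommGroup W] [InnerProductSpace ℂ W] [CompleteSpace W] [FiniteDimensional ℂ W]
  {Q : ChartOp1 E F F' k k'} {p : M} {A : E ≃L[ℝ] EuclideanSpace ℝ (Fin n)}
  {ι : (E [⋀^Fin k]→L[ℝ] F) ≃L[ℂ] V} {ι' : (E [⋀^Fin k']→L[ℝ] F') ≃L[ℂ] W}

/-- **The perturbation symbols of a transferred operator act with norm `≤ δ`** on `H₀`, if the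
derivative coefficients oscillate by at most `δ` on the outer cube region (torus multiplier bound
`IsSmooth.eNorm_conv_mFourierCoeff_le` with `ChartOp1.norm_toFOp1_p_le`). [cite: WarnerGTM94, 6.29 (1)] -/
theorem ChartOp1.eNorm_conv_toPOp1_p_le (𝒞 : CubeCutoff p A) (hQ : Q.SmoothOn (extChartAt 𝓘(ℝ, E) p).target)
    (hBI : ∀ y D, Q.B y (Complex.I • D) = Complex.I • Q.B y D)
    (hCI : ∀ y a, Q.C y (Complex.I • a) = Complex.I • Q.C y a) {δ : ℝ} (hδ : 0 ≤ δ)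
    (hB : ∀ j, ∀ y ∈ cubeRegion A (extChartAt 𝓘(ℝ, E) p p) 𝒞.ρ',
      ‖Q.dirCoeff A ι ι' hBI j y - Q.dirCoeff A ι ι' hBI j (extChartAt 𝓘(ℝ, E) p p)‖ ≤ δ)
    (i : Fin n) (c : (Fin n → ℤ) → V) (hc : Lattice.eNormSq 0 c < ⊤) :
    Lattice.eNorm 0 (Lattice.conv ((Q.toFOp1 A ι ι' 𝒞 hQ hBI hCI).toPOp1.p i) c) ≤ ENNReal.ofReal δ * Lattice.eNorm 0 c := by
  rw [Torus.FOp1.toPOp1_p]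
  exact ((Q.toFOp1 A ι ι' 𝒞 hQ hBI hCI).hp i).eNorm_conv_mFourierCoeff_le
    (fun x ↦ ChartOp1.norm_toFOp1_p_le 𝒞 hQ hBI hCI i hδ (hB i) x) hc

variable (Q A ι ι') in
/-- The sum of the norms of the frozen coefficients at the chart point (a bound for each of them).
[folklore] -/
def ChartOp1.frozenBound (hBI : ∀ y D, Q.B y (Complex.I • D) = Complex.I • Q.B y D) (p : M) : ℝ≥0∞ :=
  ∑ j, ‖Q.dirCoeff A ι ι' hBI j (extChartAt 𝓘(ℝ, E) p p)‖ₑ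

omit [CompleteSpace V] in
/-- Each frozen coefficient is bounded by `frozenBound`. [folklore] -/
theorem ChartOp1.enorm_toPOp1_P_le (𝒞 : CubeCutoff p A) (hQ : Q.SmoothOn (extChartAt 𝓘(ℝ, E) p).target)
    (hBI : ∀ y D, Q.B y (Complex.I • D) = Complex.I • Q.B y D)
    (hCI : ∀ y a, Q.C y (Complex.I • a) = Complex.I • Q.C y a) (i : Fin n) :
    ‖(Q.toFOp1 A ι ι' 𝒞 hQ hBI hCI).toPOp1.P i‖ₑ ≤ Q.frozenBound A ι ι' hBI p := by
  rw [Torus.FOp1.toPOp1_P, ChartOp1.toFOp1_P, ChartOp1.frozenBound]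
  exact Finset.single_le_sum (f := fun j ↦ ‖Q.dirCoeff A ι ι' hBI j (extChartAt 𝓘(ℝ, E) p p)‖ₑ)
    (fun _ _ ↦ zero_le) (Finset.mem_univ i)

omit [CompleteSpace V] [FiniteDimensional ℂ V] [CompleteSpace W] [FiniteDimensional ℂ W] in
/-- `frozenBound` is finite. [folklore] -/
theorem ChartOp1.frozenBound_lt_top (hBI : ∀ y D, Q.B y (Complex.I • D) = Complex.I • Q.B y D) (p : M) :
    Q.frozenBound A ι ι' hBI p < ⊤ := by
  rw [ChartOp1.frozenBound]
  exact ENNReal.sum_lt_top.2 fun _ _ ↦ enorm_lt_top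

end One

/-! ### The perturbation bound for the torus Laplacian -/

section Laplacian

variable {E : Type*} [NormedAddCommGroup E] [NormedSpace ℂ E] [FiniteDimensional ℂ E]
  {n : ℕ} [Fact (finrank ℝ E = n)]
  {M : Type*} [TopologicalSpace M] [ChartedSpace E M] [IsManifold 𝓘(ℝ, E) ∞ M]
  [RiemannianBundle (fun x : M ↦ TangentSpace 𝓘(ℝ, E) x)]
  [IsContMDiffRiemannianBundle 𝓘(ℝ, E) ∞ E (fun x : M ↦ TangentSpace 𝓘(ℝ, E) x)]
  (o : (x : M) → Orientation ℝ (TangentSpace 𝓘(ℝ, E) x) (Fin n)) {k m m' : ℕ}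

/-- **Oscillation hypothesis** for the torus Laplacian in degree `k + 1` at `p` with cube data
`(A, 𝒞)`: the transported derivative coefficients of `∂̄` (degrees `k`, `k+1`) and `∂̄*`
(degrees `k+1 → k`, `k+2 → k+1`) differ from their values at the chart point by at most `δ` on the
outer cube region (Warner 6.31: the neighbourhood is chosen small). [cite: WarnerGTM94, 6.31] -/
structure OscLE (h₁ : (k + 1) + m = n) (h₃ : (k + 1 + 1) + m' = n) {p : M}
    {A : E ≃L[ℝ] EuclideanSpace ℝ (Fin n)} (𝒞 : CubeCutoff p A) (δ : ℝ) : Prop where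
  dbar_k : ∀ j, ∀ y ∈ cubeRegion A (extChartAt 𝓘(ℝ, E) p p) 𝒞.ρ',
    ‖(dolbeaultBarOp E k).dirCoeff A (fibreIso E k) (fibreIso E (k + 1)) commI_dolbeaultBarOp.B j y -
      (dolbeaultBarOp E k).dirCoeff A (fibreIso E k) (fibreIso E (k + 1)) commI_dolbeaultBarOp.B j
        (extChartAt 𝓘(ℝ, E) p p)‖ ≤ δ
  dbar_succ : ∀ j, ∀ y ∈ cubeRegion A (extChartAt 𝓘(ℝ, E) p p) 𝒞.ρ',
    ‖(dolbeaultBarOp E (k + 1)).dirCoeff A (fibreIso E (k + 1)) (fibreIso E (k + 1 + 1)) commI_dolbeaultBarOp.B j y -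
      (dolbeaultBarOp E (k + 1)).dirCoeff A (fibreIso E (k + 1)) (fibreIso E (k + 1 + 1)) commI_dolbeaultBarOp.B j
        (extChartAt 𝓘(ℝ, E) p p)‖ ≤ δ
  adj_k : ∀ j, ∀ y ∈ cubeRegion A (extChartAt 𝓘(ℝ, E) p p) 𝒞.ρ',
    ‖(dolbeaultBarAdjointOp o h₁ p).dirCoeff A (fibreIso E (k + 1)) (fibreIso E k) (commI_dolbeaultBarAdjointOp o h₁ p).B j y -
      (dolbeaultBarAdjointOp o h₁ p).dirCoeff A (fibreIso E (k + 1)) (fibreIso E k) (commI_dolbeaultBarAdjointOp o h₁ p).B j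
        (extChartAt 𝓘(ℝ, E) p p)‖ ≤ δ
  adj_succ : ∀ j, ∀ y ∈ cubeRegion A (extChartAt 𝓘(ℝ, E) p p) 𝒞.ρ',
    ‖(dolbeaultBarAdjointOp o h₃ p).dirCoeff A (fibreIso E (k + 1 + 1)) (fibreIso E (k + 1))
        (commI_dolbeaultBarAdjointOp o h₃ p).B j y -
      (dolbeaultBarAdjointOp o h₃ p).dirCoeff A (fibreIso E (k + 1 + 1)) (fibreIso E (k + 1))
        (commI_dolbeaultBarAdjointOp o h₃ p).B j (extChartAt 𝓘(ℝ, E) p p)‖ ≤ δ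

/-- **The constant `K`** of the perturbation bound: a finite combination of the frozen-coefficient
bounds of the four first-order constituents at `p` (independent of the cut-off data). [folklore] -/
def perturbationConst (h₁ : (k + 1) + m = n) (h₃ : (k + 1 + 1) + m' = n) (p : M)
    (A : E ≃L[ℝ] EuclideanSpace ℝ (Fin n)) : ℝ≥0∞ :=
  ((dolbeaultBarOp E k).frozenBound A (fibreIso E k) (fibreIso E (k + 1)) commI_dolbeaultBarOp.B p +
      (dolbeaultBarAdjointOp o h₁ p).frozenBound A (fibreIso E (k + 1)) (fibreIso E k)
        (commI_dolbeaultBarAdjointOp o h₁ p).B p + 1) +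
    ((dolbeaultBarAdjointOp o h₃ p).frozenBound A (fibreIso E (k + 1 + 1)) (fibreIso E (k + 1))
        (commI_dolbeaultBarAdjointOp o h₃ p).B p +
      (dolbeaultBarOp E (k + 1)).frozenBound A (fibreIso E (k + 1)) (fibreIso E (k + 1 + 1)) commI_dolbeaultBarOp.B p + 1)

omit [IsContMDiffRiemannianBundle 𝓘(ℝ, E) ∞ E (fun x : M ↦ TangentSpace 𝓘(ℝ, E) x)] in
/-- The constant `K` is finite. [folklore] -/
theorem perturbationConst_lt_top (h₁ : (k + 1) + m = n) (h₃ : (k + 1 + 1) + m' = n) (p : M)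
    (A : E ≃L[ℝ] EuclideanSpace ℝ (Fin n)) : perturbationConst o h₁ h₃ p A < ⊤ := by
  simp only [perturbationConst, ENNReal.add_lt_top]
  exact ⟨⟨⟨ChartOp1.frozenBound_lt_top _ _, ChartOp1.frozenBound_lt_top _ _⟩, ENNReal.one_lt_top⟩,
    ⟨ChartOp1.frozenBound_lt_top _ _, ChartOp1.frozenBound_lt_top _ _⟩, ENNReal.one_lt_top⟩

/-- Arithmetic of the composition bound: `M_P δ + δ M_Q + δ δ ≤ δ (M_P + M_Q + 1)` for `δ ≤ 1`.
[folklore] -/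
theorem comp_bound_le {MP MQ : ℝ≥0∞} {δ : ℝ} (hδ1 : δ ≤ 1) :
    MP * ENNReal.ofReal δ + ENNReal.ofReal δ * MQ + ENNReal.ofReal δ * ENNReal.ofReal δ ≤
      ENNReal.ofReal δ * (MP + MQ + 1) := by
  have h1 : ENNReal.ofReal δ ≤ 1 := by rw [← ENNReal.ofReal_one]; exact ENNReal.ofReal_le_ofReal hδ1
  calc MP * ENNReal.ofReal δ + ENNReal.ofReal δ * MQ + ENNReal.ofReal δ * ENNReal.ofReal δ
      ≤ ENNReal.ofReal δ * MP + ENNReal.ofReal δ * MQ + ENNReal.ofReal δ * 1 := by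
        rw [mul_comm MP]; gcongr
    _ = ENNReal.ofReal δ * (MP + MQ + 1) := by ring

/-- **The principal perturbation of the torus Laplacian is at most `δ · K`** when the derivative
coefficients oscillate by at most `δ ≤ 1` on the outer cube region (Warner 6.29 (1) via 6.31).
[cite: WarnerGTM94, 6.31] -/
theorem torusLaplacian_principalPerturbationLE (ho : IsSmoothForm (riemannianVolumeForm o))
    (h₁ : (k + 1) + m = n) (h₃ : (k + 1 + 1) + m' = n) {p : M} {A : E ≃L[ℝ] EuclideanSpace ℝ (Fin n)}
    (𝒞 : CubeCutoff p A) {δ : ℝ} (hδ : 0 ≤ δ) (hδ1 : δ ≤ 1) (hosc : OscLE o h₁ h₃ 𝒞 δ) :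
    (torusLaplacian o ho h₁ h₃ 𝒞).PrincipalPerturbationLE (ENNReal.ofReal δ * perturbationConst o h₁ h₃ p A) := by
  rw [perturbationConst, mul_add]
  refine Lattice.POp.principalPerturbationLE_add ?_ ?_
  · refine fun i j c hc ↦ (Lattice.POp1.principalPerturbationLE_comp _ _
      (fun i c hc ↦ ChartOp1.eNorm_conv_toPOp1_p_le 𝒞 _ _ _ hδ hosc.dbar_k i c hc)
      (fun i c hc ↦ ChartOp1.eNorm_conv_toPOp1_p_le 𝒞 _ _ _ hδ hosc.adj_k i c hc) _ _
      (fun i ↦ ChartOp1.enorm_toPOp1_P_le 𝒞 _ _ _ i) (fun i ↦ ChartOp1.enorm_toPOp1_P_le 𝒞 _ _ _ i) i j c hc).trans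
      (mul_le_mul' (comp_bound_le hδ1) le_rfl)
  · refine fun i j c hc ↦ (Lattice.POp1.principalPerturbationLE_comp _ _
      (fun i c hc ↦ ChartOp1.eNorm_conv_toPOp1_p_le 𝒞 _ _ _ hδ hosc.adj_succ i c hc)
      (fun i c hc ↦ ChartOp1.eNorm_conv_toPOp1_p_le 𝒞 _ _ _ hδ hosc.dbar_succ i c hc) _ _
      (fun i ↦ ChartOp1.enorm_toPOp1_P_le 𝒞 _ _ _ i) (fun i ↦ ChartOp1.enorm_toPOp1_P_le 𝒞 _ _ _ i) i j c hc).trans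
      (mul_le_mul' (comp_bound_le hδ1) le_rfl)

/-! ### Degree `0` and top degree -/

/-- Oscillation hypothesis for the degree-`0` torus Laplacian (`∂̄` on functions, `∂̄*` on
`1`-forms). [cite: WarnerGTM94, 6.31] -/
structure OscLEZero (h₃ : (0 + 1) + m' = n) {p : M} {A : E ≃L[ℝ] EuclideanSpace ℝ (Fin n)}
    (𝒞 : CubeCutoff p A) (δ : ℝ) : Prop where
  dbar : ∀ j, ∀ y ∈ cubeRegion A (extChartAt 𝓘(ℝ, E) p p) 𝒞.ρ',
    ‖(dolbeaultBarOp E 0).dirCoeff A (fibreIso E 0) (fibreIso E (0 + 1)) commI_dolbeaultBarOp.B j y -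
      (dolbeaultBarOp E 0).dirCoeff A (fibreIso E 0) (fibreIso E (0 + 1)) commI_dolbeaultBarOp.B j
        (extChartAt 𝓘(ℝ, E) p p)‖ ≤ δ
  adj : ∀ j, ∀ y ∈ cubeRegion A (extChartAt 𝓘(ℝ, E) p p) 𝒞.ρ',
    ‖(dolbeaultBarAdjointOp o h₃ p).dirCoeff A (fibreIso E (0 + 1)) (fibreIso E 0) (commI_dolbeaultBarAdjointOp o h₃ p).B j y -
      (dolbeaultBarAdjointOp o h₃ p).dirCoeff A (fibreIso E (0 + 1)) (fibreIso E 0) (commI_dolbeaultBarAdjointOp o h₃ p).B j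
        (extChartAt 𝓘(ℝ, E) p p)‖ ≤ δ

/-- The constant `K` for degree `0`. [folklore] -/
def perturbationConstZero (h₃ : (0 + 1) + m' = n) (p : M) (A : E ≃L[ℝ] EuclideanSpace ℝ (Fin n)) : ℝ≥0∞ :=
  (dolbeaultBarAdjointOp o h₃ p).frozenBound A (fibreIso E (0 + 1)) (fibreIso E 0) (commI_dolbeaultBarAdjointOp o h₃ p).B p +
    (dolbeaultBarOp E 0).frozenBound A (fibreIso E 0) (fibreIso E (0 + 1)) commI_dolbeaultBarOp.B p + 1

omit [IsContMDiffRiemannianBundle 𝓘(ℝ, E) ∞ E (fun x : M ↦ TangentSpace 𝓘(ℝ, E) x)] in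
/-- `K` is finite (degree `0`). [folklore] -/
theorem perturbationConstZero_lt_top (h₃ : (0 + 1) + m' = n) (p : M) (A : E ≃L[ℝ] EuclideanSpace ℝ (Fin n)) :
    perturbationConstZero o h₃ p A < ⊤ := by
  simp only [perturbationConstZero, ENNReal.add_lt_top]
  exact ⟨⟨ChartOp1.frozenBound_lt_top _ _, ChartOp1.frozenBound_lt_top _ _⟩, ENNReal.one_lt_top⟩

/-- **Perturbation bound for the degree-`0` torus Laplacian.** [cite: WarnerGTM94, 6.31] -/
theorem torusLaplacianZero_principalPerturbationLE (ho : IsSmoothForm (riemannianVolumeForm o))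
    (h₃ : (0 + 1) + m' = n) {p : M} {A : E ≃L[ℝ] EuclideanSpace ℝ (Fin n)}
    (𝒞 : CubeCutoff p A) {δ : ℝ} (hδ : 0 ≤ δ) (hδ1 : δ ≤ 1) (hosc : OscLEZero o h₃ 𝒞 δ) :
    (torusLaplacianZero o ho h₃ 𝒞).PrincipalPerturbationLE (ENNReal.ofReal δ * perturbationConstZero o h₃ p A) := by
  rw [perturbationConstZero]
  exact fun i j c hc ↦ (Lattice.POp1.principalPerturbationLE_comp _ _
    (fun i c hc ↦ ChartOp1.eNorm_conv_toPOp1_p_le 𝒞 _ _ _ hδ hosc.adj i c hc)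
    (fun i c hc ↦ ChartOp1.eNorm_conv_toPOp1_p_le 𝒞 _ _ _ hδ hosc.dbar i c hc) _ _
    (fun i ↦ ChartOp1.enorm_toPOp1_P_le 𝒞 _ _ _ i) (fun i ↦ ChartOp1.enorm_toPOp1_P_le 𝒞 _ _ _ i) i j c hc).trans
    (mul_le_mul' (comp_bound_le hδ1) le_rfl)

/-- Oscillation hypothesis for the top-degree torus Laplacian (`∂̄*` on `n`-forms, `∂̄` on
`(n-1)`-forms). [cite: WarnerGTM94, 6.31] -/
structure OscLETop (h₁ : (k + 1) + 0 = n) {p : M} {A : E ≃L[ℝ] EuclideanSpace ℝ (Fin n)}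
    (𝒞 : CubeCutoff p A) (δ : ℝ) : Prop where
  dbar : ∀ j, ∀ y ∈ cubeRegion A (extChartAt 𝓘(ℝ, E) p p) 𝒞.ρ',
    ‖(dolbeaultBarOp E k).dirCoeff A (fibreIso E k) (fibreIso E (k + 1)) commI_dolbeaultBarOp.B j y -
      (dolbeaultBarOp E k).dirCoeff A (fibreIso E k) (fibreIso E (k + 1)) commI_dolbeaultBarOp.B j
        (extChartAt 𝓘(ℝ, E) p p)‖ ≤ δ
  adj : ∀ j, ∀ y ∈ cubeRegion A (extChartAt 𝓘(ℝ, E) p p) 𝒞.ρ',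
    ‖(dolbeaultBarAdjointOp o h₁ p).dirCoeff A (fibreIso E (k + 1)) (fibreIso E k) (commI_dolbeaultBarAdjointOp o h₁ p).B j y -
      (dolbeaultBarAdjointOp o h₁ p).dirCoeff A (fibreIso E (k + 1)) (fibreIso E k) (commI_dolbeaultBarAdjointOp o h₁ p).B j
        (extChartAt 𝓘(ℝ, E) p p)‖ ≤ δ

/-- The constant `K` for the top degree. [folklore] -/
def perturbationConstTop (h₁ : (k + 1) + 0 = n) (p : M) (A : E ≃L[ℝ] EuclideanSpace ℝ (Fin n)) : ℝ≥0∞ :=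
  (dolbeaultBarOp E k).frozenBound A (fibreIso E k) (fibreIso E (k + 1)) commI_dolbeaultBarOp.B p +
    (dolbeaultBarAdjointOp o h₁ p).frozenBound A (fibreIso E (k + 1)) (fibreIso E k)
      (commI_dolbeaultBarAdjointOp o h₁ p).B p + 1

omit [IsContMDiffRiemannianBundle 𝓘(ℝ, E) ∞ E (fun x : M ↦ TangentSpace 𝓘(ℝ, E) x)] in
/-- `K` is finite (top degree). [folklore] -/
theorem perturbationConstTop_lt_top (h₁ : (k + 1) + 0 = n) (p : M) (A : E ≃L[ℝ] EuclideanSpace ℝ (Fin n)) :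
    perturbationConstTop o h₁ p A < ⊤ := by
  simp only [perturbationConstTop, ENNReal.add_lt_top]
  exact ⟨⟨ChartOp1.frozenBound_lt_top _ _, ChartOp1.frozenBound_lt_top _ _⟩, ENNReal.one_lt_top⟩

/-- **Perturbation bound for the top-degree torus Laplacian.** [cite: WarnerGTM94, 6.31] -/
theorem torusLaplacianTop_principalPerturbationLE (ho : IsSmoothForm (riemannianVolumeForm o))
    (h₁ : (k + 1) + 0 = n) {p : M} {A : E ≃L[ℝ] EuclideanSpace ℝ (Fin n)}
    (𝒞 : CubeCutoff p A) {δ : ℝ} (hδ : 0 ≤ δ) (hδ1 : δ ≤ 1) (hosc : OscLETop o h₁ 𝒞 δ) :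
    (torusLaplacianTop o ho h₁ 𝒞).PrincipalPerturbationLE (ENNReal.ofReal δ * perturbationConstTop o h₁ p A) := by
  rw [perturbationConstTop]
  exact fun i j c hc ↦ (Lattice.POp1.principalPerturbationLE_comp _ _
    (fun i c hc ↦ ChartOp1.eNorm_conv_toPOp1_p_le 𝒞 _ _ _ hδ hosc.dbar i c hc)
    (fun i c hc ↦ ChartOp1.eNorm_conv_toPOp1_p_le 𝒞 _ _ _ hδ hosc.adj i c hc) _ _
    (fun i ↦ ChartOp1.enorm_toPOp1_P_le 𝒞 _ _ _ i) (fun i ↦ ChartOp1.enorm_toPOp1_P_le 𝒞 _ _ _ i) i j c hc).trans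
    (mul_le_mul' (comp_bound_le hδ1) le_rfl)

end Laplacian

end Literature.Geometry.Kaehler
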